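import Literature.AnabelianGeometry.EtaleTheta.TemperedFrobenioidCor38SubUnitNegative
import Literature.AlgebraicGeometry.Frobenioids.ModelFrobenioidPreFrobenioid
import HarnessLib

/-!
# [EtTh] Def. 3.6 AS TYPED: a tempered Frobenioid with SHARP `Φ = ℕ` and one with `Φ = ℤ × ℕ` (a unit) have
# EQUIVALENT model categories — the collapse equivalence (toy data, part 3)

S. Mochizuki, *The étale theta function and its Frobenioid-theoretic manifestations*, Publ. RIMS **45** (2009)
[EtTh], Def. 3.6 (i)–(ii) PDF pp. 76–77, Cor. 3.8 PDF pp. 80–82 [cite: MochizukiEtTh2009, Def 3.6 p.77]; [FrdI] Thm. 5.2 (i)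
p. 100 [cite: MochizukiFrdI2008, Thm. 5.2(i) p.100]. abc-iut cell, block F (fact-proving wave), seat abc-iut-f-135 (gen 2);
DATA file behind the schema verdict on the Cor. 3.8 sub-DAG row C38-L02b `Cor38Hyp.PreservesPrimarySteps` (FACT-LIST F-2810;
proof-only companion `TemperedFrobenioidCor38SubPrimaryNegative.lean`).

WHAT IS BUILT. Two inhabitants of the typed Def. 3.6 interface over the one-object base `D = D₀ = pt` and the trivial
[FrdI] vocabularies are already in the tree: abc-iut-L2-t3's `Toy.temperedFrobenioid` (`Φ = Φ^{ℝ-log} = ℕ`, SHARP, one prime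
`𝔭`; `B = B₀^Λ = ℤ`, `div b = b·𝔭`) and gen 0's `UnitToy.frdFull` (`Φ = ℤ × ℕ` with the UNIT `n₀ = (1,0)`; `B₀^Λ = ℤ`,
`div b = (0,b)`). In BOTH model categories ([FrdI] Thm. 5.2 (i)) every hom-set is in bijection with `ℕ_{≥1} × ℕ`
(Frobenius degree, `ℕ`-coordinate of the zero divisor — the remaining data being forced by relation (d)), composition being
`(d,z)·(d',z') = (dd', z' + d'z)`, and all objects are isomorphic. Hence the functor

* `UnitToy.collapse : frdFull.category ⥤ Toy.temperedFrobenioid.category`, every object `↦ (•, 0)`,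
  `(d, id, (z₁,z₂), u) ↦ (d, id, 𝔭^{z₂}, (z₂, 𝔭^{z₂}))`,

is full, faithful and essentially surjective (`collapse.IsEquivalence`), giving the equivalence `UnitToy.collapseEquiv` and
the record **`UnitToy.hypCollapse : Cor38Hyp frdFull Toy.temperedFrobenioid`** (Cor. 3.8's typed hypotheses: an equivalence
of the categories, `pt` of FSMFF-type — abc-iut-L1's `ArchFrd.isOfFSMFFType_discretePUnit` —, the trivial non-dilating
clauses). Also the test datum `Toy.primaryStep = (1, id, 𝔭, (1, 𝔭)) : (•,0) → (•,0)` of `Toy`.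

WHY (used in the companion). `collapse` preserves Frobenius degrees and base maps, hence pre-steps, linear morphisms and
`O^▷(−)`; what it cannot respect is PRIMALITY of zero divisors: in the sharp `ℕ` the element `𝔭` is primary ([FrdI] §0),
whereas in `ℤ × ℕ` the [FrdI] §0 condition "`b ≼ a ⇒ a ≼ b` for all `b ≠ 0`", applied to the unit `b = n₀`, forces a primary
element to be a UNIT — and a linear base-isomorphism with unit zero divisor is an isomorphism, not a step.
HONEST FRAMING: degenerate inhabitants of the TYPED interface (print's `Φ` is divisorial, hence sharp); bookkeeping about
our typing, nothing about [EtTh] itself; nothing here bears on [IUTchIII] Cor. 3.12; no side taken; typed ≠ proved.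
-/

noncomputable section

namespace Literature.AnabelianGeometry.EtaleTheta

open CategoryTheory Opposite Literature.AlgebraicGeometry.Frobenioids

/-! ## Generic bookkeeping: elements of a groupification are fractions -/

/-- Every element `g` of `N^gp` satisfies `g · b = a` for some `a, b ∈ N` ([FrdI] §0, `M^gp`). [cite: MochizukiFrdI2008, §0 p.11] -/
theorem gp_exists_mul_of_eq_of {N : Type*} [CommMonoid N] (g : Algebra.GrothendieckGroup N) :
    ∃ a b : N, g * Algebra.GrothendieckGroup.of b = Algebra.GrothendieckGroup.of a := by
  induction g using Localization.induction_on with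
  | H y =>
    refine ⟨y.1, y.2, ?_⟩
    rw [Localization.mk_eq_monoidOf_mk'_apply]
    exact Submonoid.LocalizationMap.mk'_spec _ _ _

namespace Toy

/-! ## Bookkeeping on abc-iut-L2-t3's `Toy.temperedFrobenioid` (`Φ = ℕ`, `B₀^Λ = ℤ`, `div b = b·𝔭`) -/

/-- The one object of the base. [cite: MochizukiEtTh2009, Def 3.6 p.76] -/
abbrev pt : Discrete PUnit.{1} := ⟨⟨⟩⟩

/-- The zero object `Z = (•, 0)` of the category of `Toy.temperedFrobenioid` ([FrdI] Thm. 5.2 proof).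
[cite: MochizukiFrdI2008, Thm. 5.2 p.101] -/
abbrev Z : temperedFrobenioid.category := ModelFrobenioid.zeroObj _ _ _ pt

/-- `ℕ → Φ(A) = ℕ` (the identity onto the top submonoid). [cite: MochizukiEtTh2009, Def 3.6 p.77] -/
def toΦ (A : (Discrete PUnit.{1})ᵒᵖ) : Multiplicative ℕ →* (temperedFrobenioid.divisorMonoid.obj A : Type) :=
  (MonoidHom.id (Multiplicative ℕ)).codRestrict (⊤ : Submonoid (Multiplicative ℕ)) fun _ => trivial

/-- `Φ(A) = ℕ → ℕ` (the inclusion of the top submonoid). [cite: MochizukiEtTh2009, Def 3.6 p.77] -/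
def ofΦ (A : (Discrete PUnit.{1})ᵒᵖ) : (temperedFrobenioid.divisorMonoid.obj A : Type) →* Multiplicative ℕ :=
  (⊤ : Submonoid (Multiplicative ℕ)).subtype

/-- `ofΦ ∘ toΦ = id`. [cite: MochizukiEtTh2009, Def 3.6 p.77] -/
@[simp] theorem ofΦ_toΦ (A : (Discrete PUnit.{1})ᵒᵖ) (n : Multiplicative ℕ) : ofΦ A (toΦ A n) = n := rfl

/-- `toΦ ∘ ofΦ = id`. [cite: MochizukiEtTh2009, Def 3.6 p.77] -/
@[simp] theorem toΦ_ofΦ (A : (Discrete PUnit.{1})ᵒᵖ) (x : (temperedFrobenioid.divisorMonoid.obj A : Type)) :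
    toΦ A (ofΦ A x) = x := Subtype.ext rfl

/-- `ofΦ` is injective. [cite: MochizukiEtTh2009, Def 3.6 p.77] -/
theorem ofΦ_injective (A : (Discrete PUnit.{1})ᵒᵖ) : Function.Injective (ofΦ A) :=
  fun x y h => by rw [← toΦ_ofΦ A x, ← toΦ_ofΦ A y, h]

/-- The prime `𝔭 = 1 ∈ ℕ = Φ(A)`. [cite: MochizukiEtTh2009, Def 3.6 p.77] -/
abbrev 𝔭 (A : (Discrete PUnit.{1})ᵒᵖ) : (temperedFrobenioid.divisorMonoid.obj A : Type) := toΦ A (Multiplicative.ofAdd 1)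

/-- `n ↦ (n : ℤ)` (multiplicatively). [folklore] -/
abbrev castZ : Multiplicative ℕ →* Multiplicative ℤ := AddMonoidHom.toMultiplicative (Nat.castAddMonoidHom ℤ)

/-- `𝔭 ^ n = n` in `Multiplicative ℕ`. [folklore] -/
private theorem ofAdd_one_pow (n : Multiplicative ℕ) : Multiplicative.ofAdd (1 : ℕ) ^ (Multiplicative.toAdd n) = n := by
  rw [← ofAdd_nsmul, smul_eq_mul, mul_one, ofAdd_toAdd]

/-- The classes `b ↦ b·𝔭 ∈ Φ(A)^gp` (`ℤ → ℕ^gp`). [cite: MochizukiEtTh2009, Def 3.6 p.77] -/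
def gpΦ (A : (Discrete PUnit.{1})ᵒᵖ) :
    Multiplicative ℤ →* Algebra.GrothendieckGroup (temperedFrobenioid.divisorMonoid.obj A : Type) :=
  zpowersHom _ (Algebra.GrothendieckGroup.of (𝔭 A))

/-- `gpΦ b = 𝔭^b`. [cite: MochizukiEtTh2009, Def 3.6 p.77] -/
theorem gpΦ_apply (A : (Discrete PUnit.{1})ᵒᵖ) (b : Multiplicative ℤ) :
    gpΦ A b = Algebra.GrothendieckGroup.of (𝔭 A) ^ (Multiplicative.toAdd b) := rfl

/-- `gpΦ (n : ℤ) = [n]` for `n ∈ ℕ`. [cite: MochizukiEtTh2009, Def 3.6 p.77] -/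
theorem gpΦ_castZ (A : (Discrete PUnit.{1})ᵒᵖ) (n : Multiplicative ℕ) :
    gpΦ A (castZ n) = Algebra.GrothendieckGroup.of (toΦ A n) := by
  rw [gpΦ_apply]
  change Algebra.GrothendieckGroup.of (𝔭 A) ^ ((Multiplicative.toAdd n : ℕ) : ℤ) = _
  rw [zpow_natCast, ← map_pow, ← map_pow, ofAdd_one_pow]

/-- The inclusion `Φ(A)^gp → (Φ^{ℝ-log})^gp(A)` on `gpΦ`: `ι(b·𝔭) = div(b)`. [cite: MochizukiEtTh2009, Def 3.6 p.77] -/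
theorem ΦgpToRlog_gpΦ (A : (Discrete PUnit.{1})ᵒᵖ) (b : Multiplicative ℤ) :
    temperedFrobenioid.ΦgpToRlog A (gpΦ A b) = divHom b := by
  refine (map_zpow (temperedFrobenioid.ΦgpToRlog A) (Algebra.GrothendieckGroup.of (𝔭 A))
    (Multiplicative.toAdd b)).trans ?_
  rw [divHom, zpowersHom_apply]
  change gpMap (Submonoid.subtype _) (Algebra.GrothendieckGroup.of (𝔭 A)) ^ _ = _
  rw [gpMap_of]
  rfl

/-- The degree `ℕ^gp → ℤ` on `(Φ^{ℝ-log})^gp = ℕ^gp`. [cite: MochizukiEtTh2009, Def 3.6 p.77] -/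
def degR : Algebra.GrothendieckGroup (Multiplicative ℕ) →* Multiplicative ℤ := Algebra.GrothendieckGroup.lift castZ

/-- `degR (div b) = b`: `div : B₀^Λ = ℤ → ℕ^gp` is injective. [cite: MochizukiEtTh2009, Def 3.6 p.77] -/
@[simp] theorem degR_divHom (b : Multiplicative ℤ) : degR (divHom b) = b := by
  rw [divHom, zpowersHom_apply, map_zpow, degR, UnitToy.lift_of]
  change Multiplicative.ofAdd ((1 : ℕ) : ℤ) ^ Multiplicative.toAdd b = b
  rw [Nat.cast_one, ← ofAdd_zsmul, smul_eq_mul, mul_one, ofAdd_toAdd]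

/-- The constant rational function with divisor `b·𝔭`: `(b, b·𝔭) ∈ B(A) = B₀^Λ ×_{(Φ^{ℝ-log})^gp} Φ^gp`, as a homomorphism
`ℤ → B(A)`. [cite: MochizukiEtTh2009, Def 3.6 p.77] -/
def unitT (A : (Discrete PUnit.{1})ᵒᵖ) : Multiplicative ℤ →* (temperedFrobenioid.ratFnFunctor.obj A : Type) where
  toFun b := ⟨(b, gpΦ A b), (ΦgpToRlog_gpΦ A b).symm⟩
  map_one' := Subtype.ext (Prod.ext rfl (map_one _))
  map_mul' b b' := Subtype.ext (Prod.ext rfl (map_mul _ b b'))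

/-- Components of `unitT`. [cite: MochizukiEtTh2009, Def 3.6 p.77] -/
@[simp] theorem unitT_fst (A : (Discrete PUnit.{1})ᵒᵖ) (b : Multiplicative ℤ) : (unitT A b).1.1 = b := rfl

/-- Components of `unitT`. [cite: MochizukiEtTh2009, Def 3.6 p.77] -/
@[simp] theorem unitT_snd (A : (Discrete PUnit.{1})ᵒᵖ) (b : Multiplicative ℤ) : (unitT A b).1.2 = gpΦ A b := rfl

/-- `Div_B(u) = ξ` for `u = (b, ξ) ∈ B` (bookkeeping; a private copy of abc-iut-f-136's `Toy.divB_apply` of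
`TemperedFrobenioidToyLinearRigidity.lean`, kept local to avoid the import). [cite: MochizukiEtTh2009, Def 3.6 p.77] -/
private theorem divB_apply_toy (A : (Discrete PUnit.{1})ᵒᵖ) (u : (temperedFrobenioid.ratFnFunctor.obj A : Type)) :
    divB temperedFrobenioid.divisorMonoid temperedFrobenioid.ratFnFunctor temperedFrobenioid.divBNatTrans A u = u.1.2 :=
  rfl

/-- An element of `B(A)` is determined by its divisor: `u = unitT (u.1.1)` and `u.1.2 = gpΦ u.1.1`.
[cite: MochizukiEtTh2009, Def 3.6 p.77] -/
theorem eq_unitT_of_snd_eq (A : (Discrete PUnit.{1})ᵒᵖ) (u : (temperedFrobenioid.ratFnFunctor.obj A : Type))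
    (b : Multiplicative ℤ) (hu : u.1.2 = gpΦ A b) : u = unitT A b := by
  have h1 : divHom u.1.1 = divHom b := by
    have h := u.2
    change divHom u.1.1 = temperedFrobenioid.ΦgpToRlog A u.1.2 at h
    rw [h, hu, ΦgpToRlog_gpΦ]
  have h2 : u.1.1 = b := by
    have h := congrArg degR h1
    rw [degR_divHom, degR_divHom] at h
    exact h
  exact Subtype.ext (Prod.ext h2 hu)

/-- The pull-back of `Φ` along a morphism of the one-object base is the identity (bookkeeping).
[cite: MochizukiEtTh2009, Def 3.6 p.77] -/
theorem ofΦ_map {A A' : Discrete PUnit.{1}} (f : A ⟶ A') (x : (temperedFrobenioid.divisorMonoid.obj (op A') : Type)) :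
    ofΦ (op A) ((temperedFrobenioid.divisorMonoid.map f.op).hom x) = ofΦ (op A') x := by
  obtain ⟨⟨⟩⟩ := A
  obtain ⟨⟨⟩⟩ := A'
  rw [Subsingleton.elim f (𝟙 _), op_id, temperedFrobenioid.divisorMonoid.map_id]
  rfl

/-- The pull-back of `B` along the identity is the identity (bookkeeping). [cite: MochizukiEtTh2009, Def 3.6 p.77] -/
theorem ratFnFunctor_map_id_apply (A : Discrete PUnit.{1}) (u : (temperedFrobenioid.ratFnFunctor.obj (op A) : Type)) :
    (temperedFrobenioid.ratFnFunctor.map (𝟙 A).op).hom u = u := by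
  rw [op_id, temperedFrobenioid.ratFnFunctor.map_id]
  rfl

/-- **The test datum**: the endomorphism `(1, id, 𝔭, (1, 𝔭))` of `Z = (•, 0)` — a pre-step with zero divisor the prime `𝔭`.
[cite: MochizukiEtTh2009, Cor 3.8 p.81] -/
def primaryStep : Z ⟶ Z :=
  ModelFrobenioid.mkHom Z Z 1 (𝟙 pt) (𝔭 (op pt)) (unitT (op pt) (Multiplicative.ofAdd 1)) (by
    rw [PNat.one_coe, pow_one, one_mul, map_one, one_mul, divB_apply_toy, unitT_snd, gpΦ_apply, toAdd_ofAdd, zpow_one])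

/-- Components of `primaryStep`. [cite: MochizukiEtTh2009, Cor 3.8 p.81] -/
@[simp] theorem degFr_primaryStep : ModelFrobenioid.degFr primaryStep = 1 := rfl

/-- Components of `primaryStep`. [cite: MochizukiEtTh2009, Cor 3.8 p.81] -/
@[simp] theorem div_primaryStep : ModelFrobenioid.div primaryStep = 𝔭 (op pt) := rfl

end Toy

namespace UnitToy

/-! ## Coordinates on `Φ(A) = ℤ × ℕ` and on `Φ(A)^gp` for `frdFull` -/

/-- The `ℕ`-coordinate `Φ(A) = ℤ × ℕ → ℕ`. [cite: MochizukiEtTh2009, Def 3.6 p.77] -/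
def sndN (A : (Discrete PUnit.{1})ᵒᵖ) : (frdFull.divisorMonoid.obj A : Type) →* Multiplicative ℕ :=
  (MonoidHom.snd (Multiplicative ℤ) (Multiplicative ℕ)).comp (⊤ : Submonoid M).subtype

/-- The `ℤ`-coordinate `Φ(A) = ℤ × ℕ → ℤ`. [cite: MochizukiEtTh2009, Def 3.6 p.77] -/
def fstZ (A : (Discrete PUnit.{1})ᵒᵖ) : (frdFull.divisorMonoid.obj A : Type) →* Multiplicative ℤ :=
  (MonoidHom.fst (Multiplicative ℤ) (Multiplicative ℕ)).comp (⊤ : Submonoid M).subtype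

/-- An element of `Φ(A) = ℤ × ℕ` with prescribed coordinates. [cite: MochizukiEtTh2009, Def 3.6 p.77] -/
def mkΦ (A : (Discrete PUnit.{1})ᵒᵖ) (c : Multiplicative ℤ) (n : Multiplicative ℕ) : (frdFull.divisorMonoid.obj A : Type) :=
  (⟨(c, n), Submonoid.mem_top _⟩ : ↥(⊤ : Submonoid M))

/-- Coordinates of `mkΦ`. [cite: MochizukiEtTh2009, Def 3.6 p.77] -/
@[simp] theorem fstZ_mkΦ (A : (Discrete PUnit.{1})ᵒᵖ) (c : Multiplicative ℤ) (n : Multiplicative ℕ) :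
    fstZ A (mkΦ A c n) = c := rfl

/-- Coordinates of `mkΦ`. [cite: MochizukiEtTh2009, Def 3.6 p.77] -/
@[simp] theorem sndN_mkΦ (A : (Discrete PUnit.{1})ᵒᵖ) (c : Multiplicative ℤ) (n : Multiplicative ℕ) :
    sndN A (mkΦ A c n) = n := rfl

/-- An element of `ℤ × ℕ` is determined by its two coordinates. [cite: MochizukiEtTh2009, Def 3.6 p.77] -/
theorem Φ_ext (A : (Discrete PUnit.{1})ᵒᵖ) {x y : (frdFull.divisorMonoid.obj A : Type)} (h1 : fstZ A x = fstZ A y)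
    (h2 : sndN A x = sndN A y) : x = y :=
  Subtype.ext (Prod.ext h1 h2)

/-- The `ℤ`-coordinate on `Φ(A)^gp`. [cite: MochizukiEtTh2009, Def 3.6 p.77] -/
def fstG (A : (Discrete PUnit.{1})ᵒᵖ) : Algebra.GrothendieckGroup (frdFull.divisorMonoid.obj A : Type) →* Multiplicative ℤ :=
  Algebra.GrothendieckGroup.lift (fstZ A)

/-- `fstG [x] = x₁`. [cite: MochizukiEtTh2009, Def 3.6 p.77] -/
@[simp] theorem fstG_of (A : (Discrete PUnit.{1})ᵒᵖ) (x : (frdFull.divisorMonoid.obj A : Type)) :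
    fstG A (Algebra.GrothendieckGroup.of x) = fstZ A x :=
  lift_of _ x

/-- `fstG = fst ∘ ι` with `ι : Φ(A)^gp → (Φ^{ℝ-log})^gp(A)`. [cite: MochizukiEtTh2009, Def 3.6 p.77] -/
theorem fstR_ΦgpToRlog (A : (Discrete PUnit.{1})ᵒᵖ) (ξ : Algebra.GrothendieckGroup (frdFull.divisorMonoid.obj A : Type)) :
    fstR (frdFull.ΦgpToRlog A ξ) = fstG A ξ := by
  suffices h : fstR.comp (frdFull.ΦgpToRlog A) = fstG A from DFunLike.congr_fun h ξ
  refine MonGp.hom_ext fun x => ?_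
  change fstR (gpMap (Submonoid.subtype _) (Algebra.GrothendieckGroup.of x)) = fstG A (Algebra.GrothendieckGroup.of x)
  rw [gpMap_of, fstR_of, fstG_of]
  rfl

/-- `fst(Div_B u) = 0` for every rational function `u` (`div(B₀^Λ) = 0 ⊕ ℤ`). [cite: MochizukiEtTh2009, Def 3.6 p.77] -/
theorem fstG_divB (A : (Discrete PUnit.{1})ᵒᵖ) (u : (frdFull.ratFnFunctor.obj A : Type)) :
    fstG A (divB frdFull.divisorMonoid frdFull.ratFnFunctor frdFull.divBNatTrans A u) = 1 := by
  rw [divB_apply, ← fstR_ΦgpToRlog, ← mem_ratFn, fstR_divHom]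

/-- An element of `(ℤ × ℕ)^gp ⊆ (Φ^{ℝ-log})^gp` is determined by its two coordinates `(fst, snd)`.
[cite: MochizukiEtTh2009, Def 3.6 p.77] -/
theorem eq_of_fstR_sndR {g g' : Algebra.GrothendieckGroup M} (h1 : fstR g = fstR g') (h2 : sndR g = sndR g') : g = g' := by
  -- reduce to `g'' := g / g'` with trivial coordinates
  suffices key : ∀ g'' : Algebra.GrothendieckGroup M, fstR g'' = 1 → sndR g'' = 1 → g'' = 1 by
    have h := key (g / g') (by rw [map_div, h1, div_self']) (by rw [map_div, h2, div_self'])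
    rwa [div_eq_one] at h
  intro g hg1 hg2
  obtain ⟨a, b, hab⟩ := gp_exists_mul_of_eq_of g
  have h1 := congrArg fstR hab
  have h2 := congrArg sndR hab
  rw [map_mul, hg1, one_mul, fstR_of, fstR_of] at h1
  rw [map_mul, hg2, one_mul, sndR_of, sndR_of] at h2
  have h2' : b.2 = a.2 := by
    have h := Multiplicative.ofAdd.injective h2
    exact Multiplicative.toAdd.injective (by exact_mod_cast h)
  have hba : b = a := Prod.ext h1 h2'
  rw [hba] at hab
  exact mul_right_cancel (hab.trans (one_mul _).symm)

/-- `div : B₀^Λ = ℤ → (ℤ × ℕ)^gp` hits exactly the elements with `fst = 0`: such an element is `div` of its `snd`.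
[cite: MochizukiEtTh2009, Def 3.6 p.77] -/
theorem divHom_sndR_of_fstR_eq_one {g : Algebra.GrothendieckGroup M} (hg : fstR g = 1) : divHom (sndR g) = g :=
  eq_of_fstR_sndR (by rw [fstR_divHom, hg]) (by rw [sndR_divHom])

/-- The rational function `(b, ξ) ∈ B(A)` with prescribed divisor class `ξ`, `fst ξ = 0`, `b := snd ξ`.
[cite: MochizukiEtTh2009, Def 3.6 p.77] -/
def unitOfCls (A : (Discrete PUnit.{1})ᵒᵖ) (ξ : Algebra.GrothendieckGroup (frdFull.divisorMonoid.obj A : Type))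
    (hξ : fstG A ξ = 1) : (frdFull.ratFnFunctor.obj A : Type) :=
  (⟨(sndR (frdFull.ΦgpToRlog A ξ), ξ), (divHom_sndR_of_fstR_eq_one (by rw [fstR_ΦgpToRlog, hξ]))⟩ : ↥(frdFull.ratFn A))

/-- Its divisor class is `ξ`. [cite: MochizukiEtTh2009, Def 3.6 p.77] -/
@[simp] theorem unitOfCls_snd (A : (Discrete PUnit.{1})ᵒᵖ) (ξ : Algebra.GrothendieckGroup (frdFull.divisorMonoid.obj A : Type))
    (hξ : fstG A ξ = 1) : (unitOfCls A ξ hξ).1.2 = ξ := rfl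

/-- A rational function `u ∈ B(A)` is determined by its divisor class `Div_B(u) = u.1.2`. [cite: MochizukiEtTh2009, Def 3.6 p.77] -/
theorem ratFn_ext (A : (Discrete PUnit.{1})ᵒᵖ) {u v : (frdFull.ratFnFunctor.obj A : Type)} (h : u.1.2 = v.1.2) : u = v := by
  have h1 : divHom u.1.1 = divHom v.1.1 := by rw [mem_ratFn, mem_ratFn, h]
  have h1' : u.1.1 = v.1.1 := by
    have h' := congrArg sndR h1
    rw [sndR_divHom, sndR_divHom] at h'
    exact h'
  exact Subtype.ext (Prod.ext h1' h)

/-- The `ℕ`-coordinate is unchanged by pull-back along a morphism of the one-object base (bookkeeping).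
[cite: MochizukiEtTh2009, Def 3.6 p.77] -/
theorem sndN_map {A A' : Discrete PUnit.{1}} (f : A ⟶ A') (x : (frdFull.divisorMonoid.obj (op A') : Type)) :
    sndN (op A) ((frdFull.divisorMonoid.map f.op).hom x) = sndN (op A') x := by
  obtain ⟨⟨⟩⟩ := A
  obtain ⟨⟨⟩⟩ := A'
  rw [Subsingleton.elim f (𝟙 _), divisorMonoid_map_id_apply]

/-- The pull-back on `Φ(A)^gp` along a morphism of the one-object base is the identity (bookkeeping).
[cite: MochizukiEtTh2009, Def 3.6 p.77] -/
theorem pullGp_eq_self {A A' : Discrete PUnit.{1}} (f : A ⟶ A')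
    (ξ : Algebra.GrothendieckGroup (frdFull.divisorMonoid.obj (op A') : Type)) :
    fstG (op A) (pullGp frdFull.divisorMonoid f ξ) = fstG (op A') ξ := by
  obtain ⟨⟨⟩⟩ := A
  obtain ⟨⟨⟩⟩ := A'
  rw [Subsingleton.elim f (𝟙 _), pullGp_id]

/-- Left cancellation in a groupification (bookkeeping). [folklore] -/
private theorem gp_mul_left_cancel {N : Type*} [CommMonoid N] {a x y : Algebra.GrothendieckGroup N} (h : a * x = a * y) :
    x = y := by
  have h' := congrArg (fun t => a⁻¹ * t) h
  simpa only [inv_mul_cancel_left] using h'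

/-! ## The collapse functor `frdFull.category ⥤ Toy.temperedFrobenioid.category` -/

/-- The `ℕ`-coordinate of the zero divisor of a morphism of `frdFull.category`, read in `Toy`'s `Φ = ℕ`.
[cite: MochizukiEtTh2009, Def 3.6 p.77] -/
abbrev divN {X Y : frdFull.category} (φ : X ⟶ Y) : Multiplicative ℕ := sndN _ (ModelFrobenioid.div φ)

/-- `divN` of a composite: `divN (φ ≫ ψ) = divN ψ · (divN φ)^{deg ψ}`. [cite: MochizukiFrdI2008, Thm. 5.2(i) p.100] -/
theorem divN_comp {X Y W : frdFull.category} (φ : X ⟶ Y) (ψ : Y ⟶ W) :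
    divN (φ ≫ ψ) = divN ψ * divN φ ^ (ModelFrobenioid.degFr ψ : ℕ) := by
  change sndN _ ((frdFull.divisorMonoid.map (ModelFrobenioid.baseMap φ).op).hom (ModelFrobenioid.div ψ) *
    ModelFrobenioid.div φ ^ (ModelFrobenioid.degFr ψ : ℕ)) = _
  rw [map_mul, map_pow, sndN_map]

/-- **The collapse functor**: every object to `Z = (•, 0)`, `(d, id, (z₁,z₂), u) ↦ (d, id, 𝔭^{z₂}, (z₂, 𝔭^{z₂}))`.
[cite: MochizukiEtTh2009, Cor 3.8 p.80] -/
def collapse : frdFull.category ⥤ Toy.temperedFrobenioid.category where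
  obj _ := Toy.Z
  map φ := ModelFrobenioid.mkHom Toy.Z Toy.Z (ModelFrobenioid.degFr φ) (𝟙 Toy.pt) (Toy.toΦ _ (divN φ))
    (Toy.unitT _ (Toy.castZ (divN φ))) (by
      rw [one_pow, one_mul, map_one, one_mul, Toy.divB_apply_toy, Toy.unitT_snd, Toy.gpΦ_castZ])
  map_id X := by
    refine ModelFrobenioid.hom_ext rfl rfl ?_ ?_
    · change Toy.toΦ _ (sndN _ (1 : (frdFull.divisorMonoid.obj _ : Type))) = 1
      rw [map_one, map_one]
    · change Toy.unitT _ (Toy.castZ (sndN _ (1 : (frdFull.divisorMonoid.obj _ : Type)))) = 1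
      rw [map_one, map_one, map_one]
  map_comp φ ψ := by
    refine ModelFrobenioid.hom_ext rfl (Subsingleton.elim _ _) ?_ ?_
    · change Toy.toΦ _ (divN (φ ≫ ψ)) =
        (Toy.temperedFrobenioid.divisorMonoid.map (𝟙 Toy.pt).op).hom (Toy.toΦ _ (divN ψ)) *
          Toy.toΦ _ (divN φ) ^ (ModelFrobenioid.degFr ψ : ℕ)
      rw [divN_comp, map_mul, map_pow]
      apply Toy.ofΦ_injective
      rw [map_mul, map_mul, Toy.ofΦ_map]
    · change Toy.unitT _ (Toy.castZ (divN (φ ≫ ψ))) =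
        (Toy.temperedFrobenioid.ratFnFunctor.map (𝟙 Toy.pt).op).hom (Toy.unitT _ (Toy.castZ (divN ψ))) *
          Toy.unitT _ (Toy.castZ (divN φ)) ^ (ModelFrobenioid.degFr ψ : ℕ)
      rw [divN_comp, map_mul, map_pow, map_mul, map_pow, Toy.ratFnFunctor_map_id_apply]

/-- Components of `collapse.map`. [cite: MochizukiEtTh2009, Cor 3.8 p.80] -/
@[simp] theorem degFr_collapse_map {X Y : frdFull.category} (φ : X ⟶ Y) :
    ModelFrobenioid.degFr (collapse.map φ) = ModelFrobenioid.degFr φ := rfl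

/-- Components of `collapse.map`. [cite: MochizukiEtTh2009, Cor 3.8 p.80] -/
@[simp] theorem div_collapse_map {X Y : frdFull.category} (φ : X ⟶ Y) :
    ModelFrobenioid.div (collapse.map φ) = Toy.toΦ _ (divN φ) := rfl

/-- Components of `collapse.map`. [cite: MochizukiEtTh2009, Cor 3.8 p.80] -/
@[simp] theorem unit_collapse_map {X Y : frdFull.category} (φ : X ⟶ Y) :
    ModelFrobenioid.unit (collapse.map φ) = Toy.unitT _ (Toy.castZ (divN φ)) := rfl

/-- `collapse` is FAITHFUL: a morphism of `frdFull.category` is determined by its Frobenius degree and the `ℕ`-coordinate of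
its zero divisor (the `ℤ`-coordinate and the rational function are forced by relation (d)). [cite: MochizukiFrdI2008, Thm. 5.2(i) p.100] -/
theorem collapse_faithful : collapse.Faithful where
  map_injective := by
    intro X Y φ₁ φ₂ h
    have hd : ModelFrobenioid.degFr φ₁ = ModelFrobenioid.degFr φ₂ := by
      rw [← degFr_collapse_map φ₁, h, degFr_collapse_map]
    have hn : divN φ₁ = divN φ₂ := by
      rw [← Toy.ofΦ_toΦ (op Toy.pt) (divN φ₁), ← div_collapse_map, h, div_collapse_map, Toy.ofΦ_toΦ]
    have hb : ModelFrobenioid.baseMap φ₁ = ModelFrobenioid.baseMap φ₂ := Subsingleton.elim _ _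
    have r₁ := congrArg (fstG _) (ModelFrobenioid.rel φ₁)
    have r₂ := congrArg (fstG _) (ModelFrobenioid.rel φ₂)
    rw [map_mul, map_mul, map_pow, fstG_of, fstG_divB, mul_one] at r₁ r₂
    rw [hd, hb, ← r₂] at r₁
    have hz : ModelFrobenioid.div φ₁ = ModelFrobenioid.div φ₂ := Φ_ext _ (mul_left_cancel r₁) hn
    have s₁ := ModelFrobenioid.rel φ₁
    rw [hd, hb, hz, ModelFrobenioid.rel φ₂] at s₁
    have hu : ModelFrobenioid.unit φ₂ = ModelFrobenioid.unit φ₁ := ratFn_ext _ (gp_mul_left_cancel s₁)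
    exact ModelFrobenioid.hom_ext hd hb hz hu.symm

/-- `collapse` is FULL: for objects `(•, α)`, `(•, β)` and `(d, id, 𝔭^m, (m, 𝔭^m)) : Z → Z`, the morphism
`(d, id, (c, m), u) : (•,α) → (•,β)` with `c := fst(β) · fst(α)^{-d}` and `u` the rational function of divisor class
`α^d · (c,m) · β⁻¹` is a preimage. [cite: MochizukiFrdI2008, Thm. 5.2(i) p.100] -/
theorem collapse_full : collapse.Full where
  map_surjective := by
    rintro ⟨⟨⟨⟩⟩, α⟩ ⟨⟨⟨⟩⟩, β⟩ χ
    -- the data of the preimage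
    let d : ℕ+ := ModelFrobenioid.degFr χ
    let m : Multiplicative ℕ := Toy.ofΦ _ (ModelFrobenioid.div χ)
    let c : Multiplicative ℤ := (fstG (op pt) α ^ (d : ℕ))⁻¹ * fstG (op pt) β
    let z : (frdFull.divisorMonoid.obj (op pt) : Type) := mkΦ _ c m
    let ξ : Algebra.GrothendieckGroup (frdFull.divisorMonoid.obj (op pt) : Type) :=
      α ^ (d : ℕ) * Algebra.GrothendieckGroup.of z * β⁻¹
    have hξ : fstG (op pt) ξ = 1 := by
      simp only [ξ, z, c, map_mul, map_pow, map_inv, fstG_of, fstZ_mkΦ]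
      rw [mul_inv_cancel_left, mul_inv_cancel]
    -- `χ`'s rational function is forced by its divisor (relation (d) at `Z`)
    have hχ : Algebra.GrothendieckGroup.of (ModelFrobenioid.div χ) = (ModelFrobenioid.unit χ).1.2 := by
      have h : (1 : Algebra.GrothendieckGroup (Toy.temperedFrobenioid.divisorMonoid.obj (op Toy.pt) : Type)) ^
            (ModelFrobenioid.degFr χ : ℕ) * Algebra.GrothendieckGroup.of (ModelFrobenioid.div χ) =
          pullGp Toy.temperedFrobenioid.divisorMonoid (ModelFrobenioid.baseMap χ) 1 *
            divB Toy.temperedFrobenioid.divisorMonoid Toy.temperedFrobenioid.ratFnFunctor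
              Toy.temperedFrobenioid.divBNatTrans _ (ModelFrobenioid.unit χ) :=
        ModelFrobenioid.rel χ
      rw [one_pow, one_mul, map_one, one_mul, Toy.divB_apply_toy] at h
      exact h
    refine ⟨ModelFrobenioid.mkHom _ _ d (𝟙 pt) z (unitOfCls _ ξ hξ) ?_, ?_⟩
    · rw [pullGp_id, divB_apply, unitOfCls_snd]
      change α ^ (d : ℕ) * Algebra.GrothendieckGroup.of z = β * (α ^ (d : ℕ) * Algebra.GrothendieckGroup.of z * β⁻¹)
      rw [mul_comm β, inv_mul_cancel_right]
    · refine ModelFrobenioid.hom_ext rfl (Subsingleton.elim _ _) ?_ ?_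
      · change Toy.toΦ _ (sndN _ (mkΦ _ c m)) = ModelFrobenioid.div χ
        rw [sndN_mkΦ, Toy.toΦ_ofΦ]
      · change Toy.unitT _ (Toy.castZ (sndN _ (mkΦ _ c m))) = ModelFrobenioid.unit χ
        rw [sndN_mkΦ]
        refine (Toy.eq_unitT_of_snd_eq _ _ _ ?_).symm
        rw [← hχ, Toy.gpΦ_castZ, Toy.toΦ_ofΦ]

/-- `collapse` is ESSENTIALLY SURJECTIVE: every object `(•, c)` of `Toy`'s category is isomorphic to `Z` through the
pre-step `(1, id, 0, (-deg c)·𝔭-unit)`. [cite: MochizukiFrdI2008, Thm. 5.2(i) p.100] -/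
theorem collapse_essSurj : collapse.EssSurj where
  mem_essImage := by
    rintro ⟨⟨⟨⟩⟩, c⟩
    -- `c = gpΦ b` for `b := degree of c`
    obtain ⟨x, y, hxy⟩ := gp_exists_mul_of_eq_of c
    let b : Multiplicative ℤ := Toy.castZ (Toy.ofΦ _ x) / Toy.castZ (Toy.ofΦ _ y)
    have hc : c = Toy.gpΦ (op Toy.pt) b := by
      rw [map_div, Toy.gpΦ_castZ, Toy.gpΦ_castZ, Toy.toΦ_ofΦ, Toy.toΦ_ofΦ, ← hxy, mul_div_cancel_right]
    let φ : Toy.Z ⟶ ⟨⟨⟨⟩⟩, c⟩ :=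
      ModelFrobenioid.mkHom _ _ 1 (𝟙 Toy.pt) 1 (Toy.unitT _ b⁻¹) (by
        rw [PNat.one_coe, pow_one, map_one, mul_one, pullGp_id, Toy.divB_apply_toy, Toy.unitT_snd, map_inv, ← hc]
        change (1 : Algebra.GrothendieckGroup _) = c * c⁻¹
        rw [mul_inv_cancel])
    haveI : IsIso (ModelFrobenioid.baseMap φ) := (inferInstance : IsIso (𝟙 Toy.pt))
    have hiso : IsIso φ := ModelFrobenioid.isIso_of
      (Toy.temperedFrobenioid.ratFnFunctor_isGroupLike Toy.realified.isUnit_BΛ) φ rfl rfl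
    exact ⟨A0, ⟨@asIso _ _ _ _ φ hiso⟩⟩

/-- **`collapse` is an equivalence of categories** (full, faithful, essentially surjective). No `instance` is declared
(cell typing rule); the equivalence below is built from this theorem explicitly. [cite: MochizukiEtTh2009, Cor 3.8 p.80] -/
theorem collapse_isEquivalence : collapse.IsEquivalence := ⟨collapse_faithful, collapse_full, collapse_essSurj⟩

/-- **The equivalence `frdFull.category ≌ Toy.temperedFrobenioid.category`** (functor `= collapse`; inverse, unit and
counit by choice from fullness / essential surjectivity, Mathlib's `Functor.asEquivalence`).
[cite: MochizukiEtTh2009, Cor 3.8 p.80] -/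
def collapseEquiv : frdFull.category ≌ Toy.temperedFrobenioid.category :=
  @Functor.asEquivalence _ _ _ _ collapse collapse_isEquivalence

/-- The functor of `collapseEquiv` is `collapse`. [cite: MochizukiEtTh2009, Cor 3.8 p.80] -/
theorem collapseEquiv_functor : collapseEquiv.functor = collapse := rfl

/-- **The data of Cor. 3.8 AS TYPED, third witness**: `C₁ = frdFull` (`Φ = ℤ × ℕ`), `C₂ = Toy.temperedFrobenioid`
(`Φ = ℕ`), `Ψ = collapseEquiv`; `D₁ = D₂ = pt` of FSMFF-type; "non-dilating" the (trivial) vocabulary clauses.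
[cite: MochizukiEtTh2009, Cor 3.8 p.80] -/
def hypCollapse : Cor38Hyp frdFull Toy.temperedFrobenioid :=
  ⟨collapseEquiv, ⟨ArchFrd.isOfFSMFFType_discretePUnit, ArchFrd.isOfFSMFFType_discretePUnit⟩,
    ⟨fun _ _ => trivial, fun _ _ => trivial⟩⟩

end UnitToy

end Literature.AnabelianGeometry.EtaleTheta

end
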